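import Summits.AtomisticToContinuum.Crystallization.Theorems.ThreeConeCertificateSlackRigidityPricedFloorsDefs
import HarnessLib

/-!
# `SlackRigidity` (stmt-AtomisticToContinuum-11960), line `priced-floors-palm-exactification`, stub S3
# (`stub_layeredMeanSelection`): vocabulary for layer functionals of exactly layered samples

Lead c19.  Stub S3 integrates GEOMETRIC functionals of a rooted, globally exactly layered
configuration (the in-plane spacing, the layer heights and stacking letters seen from the root's
layer, energies of the restacked competitor) against point-stationary laws.  Such functionals are
defined through the NORMAL-FORM LAYERING DATA fitting the configuration; since the data are not unique
(finitely many presentations of the same layered set), a functional of the data is turned into a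
functional of the configuration by taking the supremum over all fitting data (`dataSup`), which is the
common value whenever the data functional is presentation-invariant.  This file only fixes the
vocabulary (parametrised definitions, no closed `Prop`s):

* `LData` — the data space `(E3 →L[ℝ] E3) × ℝ × (ℤ → ℤ) × (ℤ → ℝ)` (frame, spacing, word, heights),
  a product of first-countable spaces in which the normal-form data form a COMPACT set
  (`SlackRigidityPricedFloorsExactify.isCompact_data`);
* `IsNormalData e` — the frame is an isometry, `(a, s, z)` is admissible, `z 0 = 0`;
* `dataSet e` — the layered set presented by `e` (equal to `layeredSet e.1.toLinearIsometry …` for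
  isometric frames; written with the continuous linear map so that it makes sense on all of `LData`);
* `Fits S e` — `e` is normal-form data presenting exactly the set `S`;
* `dataSup φ S` — the supremum of `φ` over the data fitting `S` (`0` if none: `Real.sSup_empty`).

API: `dataSet_eq_layeredSet`, `fits_iff`, `globalLayered_iff_exists_fits` (for rooted sets), monotone
facts on `dataSup`.
-/

noncomputable section

open MeasureTheory Filter Set
open scoped ENNReal BigOperators Topology

namespace Summit.AtomisticToContinuum.Crystallization.Theorems.SlackRigidityPricedFloors

open Literature.Probability.Process
open Literature.MathematicalPhysics.StatisticalMechanics

/-- **Layering data space**: frame `T : E3 →L[ℝ] E3` (an isometry for genuine data), in-plane spacing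
`a`, stacking word `s`, layer heights `z`; product topology (operator norm × reals × pointwise). -/
abbrev LData := (E3 →L[ℝ] E3) × ℝ × (ℤ → ℤ) × (ℤ → ℝ)

/-- **Normal-form data**: isometric frame, admissible `(a, s, z)` (item 13958's box), and `z 0 = 0`
(the root is the pattern point of indices `(0,0,0)`).  These form a compact subset of `LData`
(`SlackRigidityPricedFloorsExactify.isCompact_data`). -/
def IsNormalData (e : LData) : Prop :=
  (∀ v : E3, ‖e.1 v‖ = ‖v‖) ∧ IsAdmissibleLayering e.2.1 e.2.2.1 e.2.2.2 ∧ e.2.2.2 0 = 0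

/-- **The layered set presented by the data `e`** (meaningful for every `e : LData`; for an isometric
frame it is `layeredSet` of the corresponding linear isometry, `dataSet_eq_layeredSet`). -/
def dataSet (e : LData) : Set E3 :=
  {p | ∃ m i j : ℤ, p = e.1 (((i : ℝ) • triangularVec₁ e.2.1) + ((j : ℝ) • triangularVec₂ e.2.1) +
    ((haggLabel e.2.2.1 m : ℝ) • barlowOffset e.2.1) + (e.2.2.2 m • layerNormal 1))}

/-- **`e` fits `S`**: `e` is normal-form data presenting exactly the set `S`. -/
def Fits (S : Set E3) (e : LData) : Prop :=
  IsNormalData e ∧ dataSet e = S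

/-- **Supremum of a data functional over the data fitting `S`** (`0` if no data fit, by
`Real.sSup_empty`; a maximum when `φ` is continuous, the fitting data being compact).  For a
presentation-invariant `φ` this is the common value of `φ` on the fitting data. -/
def dataSup (φ : LData → ℝ) (S : Set E3) : ℝ :=
  sSup (φ '' {e | Fits S e})

/-! ## API -/

/-- The linear isometry of an isometric continuous linear frame. -/
def frameIsometry (T : E3 →L[ℝ] E3) (hT : ∀ v : E3, ‖T v‖ = ‖v‖) : E3 →ₗᵢ[ℝ] E3 :=
  { T.toLinearMap with norm_map' := hT }

/-- `frameIsometry` acts as the frame. -/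
@[simp] theorem frameIsometry_apply (T : E3 →L[ℝ] E3) (hT : ∀ v : E3, ‖T v‖ = ‖v‖) (v : E3) :
    frameIsometry T hT v = T v := rfl

/-- For an isometric frame, `dataSet` is the `layeredSet` of the corresponding linear isometry. -/
theorem dataSet_eq_layeredSet (e : LData) (hT : ∀ v : E3, ‖e.1 v‖ = ‖v‖) :
    dataSet e = layeredSet (frameIsometry e.1 hT) e.2.1 e.2.2.1 e.2.2.2 := rfl

/-- The data tuple of a linear isometry and `(a, s, z)`. -/
theorem dataSet_mk (A : E3 →ₗᵢ[ℝ] E3) (a : ℝ) (s : ℤ → ℤ) (z : ℤ → ℝ) :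
    dataSet (A.toContinuousLinearMap, a, s, z) = layeredSet A a s z := rfl

/-- Unfolding `Fits`. -/
theorem fits_iff (S : Set E3) (e : LData) : Fits S e ↔ IsNormalData e ∧ dataSet e = S := Iff.rfl

/-- Normal-form data of a linear isometry fit their own layered set. -/
theorem fits_layeredSet {A : E3 →ₗᵢ[ℝ] E3} {a : ℝ} {s : ℤ → ℤ} {z : ℤ → ℝ}
    (hadm : IsAdmissibleLayering a s z) (hz0 : z 0 = 0) :
    Fits (layeredSet A a s z) (A.toContinuousLinearMap, a, s, z) :=
  ⟨⟨fun v => A.norm_map v, hadm, hz0⟩, dataSet_mk A a s z⟩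

/-- A set fitted by some data is globally layered (with translation `0`). -/
theorem globalLayered_of_fits {S : Set E3} {e : LData} (h : Fits S e) : GlobalLayered S := by
  obtain ⟨⟨hT, hadm, -⟩, hS⟩ := h
  refine ⟨frameIsometry e.1 hT, 0, e.2.1, e.2.2.1, e.2.2.2, hadm, ?_⟩
  rw [← dataSet_eq_layeredSet e hT, hS]
  simp

/-- Registered form of `globalLayered_of_fits` (sub-goal `fits_globalLayered` of the line). -/
theorem fits_globalLayered : ∀ (S : Set E3) (e : LData), Fits S e → GlobalLayered S :=
  fun _ _ h => globalLayered_of_fits h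

/-- `dataSup` of a functional bounded above on the fitting data bounds `φ` there. -/
theorem le_dataSup {φ : LData → ℝ} {S : Set E3} (hb : BddAbove (φ '' {e | Fits S e})) {e : LData}
    (he : Fits S e) : φ e ≤ dataSup φ S :=
  le_csSup hb ⟨e, he, rfl⟩

/-- With no fitting data, `dataSup φ S = 0`. -/
theorem dataSup_of_isEmpty {φ : LData → ℝ} {S : Set E3} (h : {e | Fits S e} = ∅) :
    dataSup φ S = 0 := by
  rw [dataSup, h, Set.image_empty, Real.sSup_empty]

/-- A presentation-invariant functional: `dataSup φ S = φ e` for every fitting `e`. -/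
theorem dataSup_eq_of_forall_eq {φ : LData → ℝ} {S : Set E3} {e : LData} (he : Fits S e)
    (hinv : ∀ e', Fits S e' → φ e' = φ e) : dataSup φ S = φ e := by
  have himg : φ '' {e' | Fits S e'} = {φ e} := by
    ext x
    simp only [mem_image, mem_setOf_eq, mem_singleton_iff]
    constructor
    · rintro ⟨e', he', rfl⟩; exact hinv e' he'
    · rintro rfl; exact ⟨e, he, rfl⟩
  rw [dataSup, himg, csSup_singleton]

end Summit.AtomisticToContinuum.Crystallization.Theorems.SlackRigidityPricedFloors

end
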